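import Literature.Analysis.FluidPDE.NullLagrangianDeterminant
import Literature.Analysis.FluidPDE.WholeSpaceIBPIntegrable
import Literature.Analysis.FunctionSpaces.PeriodicPrimitive
import Mathlib.Analysis.Calculus.BumpFunction.InnerProduct

/-!
# Crux `HodographBetchov.ClassBudgetsRegularise` (stmt-NavierStokesRegularity-16863), line `birth` —
# the velocity-class null-Lagrangian (hodograph) identities (helpers for stub 1)

For a `C²` vector field `V : ℝ³ → ℝ³` which is bounded, has bounded gradient and `|∇V|² ∈ L¹`
(every time slice of a classical Navier–Stokes solution in Tao's `L^∞_t H^k_x` class), and every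
speed level `l > 0`:

* `integral_det_fderiv_eq_zero` — `∫ det ∇V dx = 0` (the Jacobian determinant is a null
  Lagrangian: `det ∇V = div (V₀ ∇V₁ × ∇V₂)`);
* `slowClass_det_integral_eq_zero` (the registered helper stub) — **the slow-class identity**
  `∫_{‖V‖ ≤ l} det ∇V dx = 0`, DECAY-FREE and DEGREE-FREE: for a `C¹` weight `b` on velocity
  space, `(∂₀ b)(V) det ∇V = div (b(V) ∇V₁ × ∇V₂)` (`inner_cross_gradient_comp`: the rows
  `∇V₁, ∇V₂` are orthogonal to `∇V₁ × ∇V₂` and `⟪∇V₀, ∇V₁ × ∇V₂⟫ = det ∇V`), the flux is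
  `≤ sup|b(V)| · ½|∇V|² ∈ L¹` and its divergence `≤ sup|∇b(V)| · ½‖∇V‖ |∇V|² ∈ L¹` (the sups over
  the compact closed ball containing the range of `V`), so the `L¹` divergence theorem
  (`integral_mul_divergence_add_eq_zero_of_integrable`) gives `∫ (∂₀ b)(V) det ∇V = 0`
  (`integral_fderiv_comp_mul_det_eq_zero`); with `b` the primitive along the first velocity
  axis of a smooth bump `= 1` on the closed ball of radius `l` (`contDiff_linePrimitive`,
  `fderiv_linePrimitive_apply`, by the tree's `contDiff_parametric_primitive` and the fundamental
  theorem of calculus) and dominated convergence as the bumps shrink to the indicator of the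
  closed ball, the slow-class identity follows; `b y = y₀` gives the global one.

These are the identities behind "Betchov on velocity classes" (route supports
`HodographConditioning` / `VelocityClassBetchov`) in exactly the generality the enstrophy ledger of
stub 1 consumes (no decay of `V` at infinity, no Brouwer degree, no area formula).

References: J. M. Ball, Arch. Ration. Mech. Anal. 63 (1977), §3; L. C. Evans, *Partial
Differential Equations*, §8.1.4.b; R. Betchov, J. Fluid Mech. 1 (1956).
-/

noncomputable section

open MeasureTheory Set Function Filter Topology InnerProductSpace
open scoped RealInnerProductSpace ContDiff ENNReal

-- the summit and its single sub-problem share the name (CONVENTIONS §1), as in every Theorems file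
set_option linter.dupNamespace false

namespace Summit.NavierStokesRegularity.NavierStokesRegularity.Theorems.ClassBudgetsRegularise

open Literature.Analysis Literature.Analysis.FluidPDE Literature.Analysis.FunctionSpaces

/-- `⟪v, v × w⟫ = 0`. [folklore] -/
theorem inner_self_cross (v w : EuclideanSpace ℝ (Fin 3)) : ⟪v, cross v w⟫ = 0 := by
  rw [cross, EuclideanSpace.inner_eq_star_dotProduct]
  simp [dotProduct_comm, dot_self_cross]

/-- `⟪w, v × w⟫ = 0`. [folklore] -/
theorem inner_self_cross' (v w : EuclideanSpace ℝ (Fin 3)) : ⟪w, cross v w⟫ = 0 := by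
  rw [cross, EuclideanSpace.inner_eq_star_dotProduct]
  simp [dotProduct_comm, dot_cross_self]

/-- **Pointwise null-Lagrangian identity**: with `Y = ∇V₁ × ∇V₂` and `θ = b ∘ V`,
`⟪Y, ∇θ⟫ = (∂₀ b)(V) det ∇V` (chain rule; the rows `∇V₁`, `∇V₂` are orthogonal to `Y` and
`⟪∇V₀, Y⟫ = det ∇V`). [cite: Evans2010, §8.1.4.b] -/
theorem inner_cross_gradient_comp {V : EuclideanSpace ℝ (Fin 3) → EuclideanSpace ℝ (Fin 3)}
    {b : EuclideanSpace ℝ (Fin 3) → ℝ} {x : EuclideanSpace ℝ (Fin 3)}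
    (hV : DifferentiableAt ℝ V x) (hb : DifferentiableAt ℝ b (V x)) :
    ⟪cross (gradient (fun z => V z 1) x) (gradient (fun z => V z 2) x), gradient (fun z => b (V z)) x⟫ =
      fderiv ℝ b (V x) (EuclideanSpace.single 0 1) * (fderiv ℝ V x).det := by
  set Y := cross (gradient (fun z => V z 1) x) (gradient (fun z => V z 2) x) with hY
  -- `⟪Y, ∇θ⟫ = Dθ(Y) = Db(V x) (DV x Y)`
  have h1 : ⟪Y, gradient (fun z => b (V z)) x⟫ = fderiv ℝ b (V x) (fderiv ℝ V x Y) := by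
    rw [real_inner_comm, gradient, InnerProductSpace.toDual_symm_apply]
    rw [show (fun z => b (V z)) = b ∘ V from rfl, fderiv_comp x hb hV]
    rfl
  -- expand `DV x Y` in the standard basis
  have h2 : fderiv ℝ V x Y = ∑ i, fderiv ℝ V x Y i • EuclideanSpace.single i (1 : ℝ) := by
    have h := (EuclideanSpace.basisFun (Fin 3) ℝ).sum_repr (fderiv ℝ V x Y)
    conv_lhs => rw [← h]
    refine Finset.sum_congr rfl fun j _ => ?_
    rw [EuclideanSpace.basisFun_repr, EuclideanSpace.basisFun_apply]
  have hcoord : ∀ i, fderiv ℝ V x Y i = ⟪gradient (fun z => V z i) x, Y⟫ := fun i =>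
    (inner_gradient_coord_eq hV i Y).symm
  have hc0 : fderiv ℝ V x Y 0 = (fderiv ℝ V x).det := by
    rw [hcoord, ContinuousLinearMap.det, det_fderiv_eq_inner_gradient_cross hV]
  have hc1 : fderiv ℝ V x Y 1 = 0 := by rw [hcoord, hY, inner_self_cross]
  have hc2 : fderiv ℝ V x Y 2 = 0 := by rw [hcoord, hY, inner_self_cross']
  rw [h1, h2, Fin.sum_univ_three, hc0, hc1, hc2]
  simp [mul_comm]

/-- `‖∇V₁ × ∇V₂‖ ≤ ½ |DV|²_F`. [folklore] -/
theorem norm_cross_gradient_le {V : EuclideanSpace ℝ (Fin 3) → EuclideanSpace ℝ (Fin 3)}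
    {x : EuclideanSpace ℝ (Fin 3)} (hV : DifferentiableAt ℝ V x) :
    ‖cross (gradient (fun z => V z 1) x) (gradient (fun z => V z 2) x)‖ ≤
      (1 / 2) * frobeniusNormSq (fderiv ℝ V x) := by
  set g1 := gradient (fun z => V z 1) x
  set g2 := gradient (fun z => V z 2) x
  have hcross : ‖cross g1 g2‖ ≤ ‖g1‖ * ‖g2‖ := by
    rw [norm_cross]
    exact mul_le_of_le_one_right (by positivity) (Real.sin_le_one _)
  have hF := frobeniusNormSq_fderiv_eq_sum_norm_gradient_sq hV
  rw [hF]
  nlinarith [sq_nonneg (‖g1‖ - ‖g2‖), sq_nonneg ‖gradient (fun z => V z 0) x‖, norm_nonneg g1,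
    norm_nonneg g2]

/-- `|det DV| ≤ ½ ‖DV‖ |DV|²_F` (triple product). [folklore] -/
theorem abs_det_fderiv_le {V : EuclideanSpace ℝ (Fin 3) → EuclideanSpace ℝ (Fin 3)}
    {x : EuclideanSpace ℝ (Fin 3)} (hV : DifferentiableAt ℝ V x) :
    |(fderiv ℝ V x).det| ≤ (1 / 2) * ‖fderiv ℝ V x‖ * frobeniusNormSq (fderiv ℝ V x) := by
  -- a row is bounded by the operator norm: `‖∇V₀‖ ≤ ‖DV‖`
  -- (cf. `RellichScarScarRigidity.norm_gradient_coord_le`, not imported to keep the cone small)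
  have hrow : ‖gradient (fun z => V z 0) x‖ ≤ ‖fderiv ℝ V x‖ := by
    set g := gradient (fun z => V z 0) x with hg
    have h : ‖g‖ ^ 2 ≤ ‖fderiv ℝ V x‖ * ‖g‖ := by
      rw [← real_inner_self_eq_norm_sq, hg, inner_gradient_coord_eq hV 0]
      calc fderiv ℝ V x (gradient (fun z => V z 0) x) 0
          ≤ |fderiv ℝ V x (gradient (fun z => V z 0) x) 0| := le_abs_self _
        _ ≤ ‖fderiv ℝ V x (gradient (fun z => V z 0) x)‖ := by
            simpa [Real.norm_eq_abs] using PiLp.norm_apply_le (fderiv ℝ V x (gradient (fun z => V z 0) x)) 0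
        _ ≤ ‖fderiv ℝ V x‖ * ‖gradient (fun z => V z 0) x‖ := (fderiv ℝ V x).le_opNorm _
    by_cases h0 : ‖g‖ = 0
    · rw [h0]; exact norm_nonneg _
    · exact le_of_mul_le_mul_right (by nlinarith [h]) (lt_of_le_of_ne (norm_nonneg _) (Ne.symm h0))
  rw [ContinuousLinearMap.det, det_fderiv_eq_inner_gradient_cross hV]
  calc |⟪gradient (fun z => V z 0) x, cross (gradient (fun z => V z 1) x) (gradient (fun z => V z 2) x)⟫|
      ≤ ‖gradient (fun z => V z 0) x‖ * ‖cross (gradient (fun z => V z 1) x) (gradient (fun z => V z 2) x)‖ :=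
        abs_real_inner_le_norm _ _
    _ ≤ ‖fderiv ℝ V x‖ * ((1 / 2) * frobeniusNormSq (fderiv ℝ V x)) :=
        mul_le_mul hrow (norm_cross_gradient_le hV) (norm_nonneg _) (norm_nonneg _)
    _ = (1 / 2) * ‖fderiv ℝ V x‖ * frobeniusNormSq (fderiv ℝ V x) := by ring

/-- **Core lemma**: `∫ (∂₀ b)(V x) det ∇V(x) dx = 0` for `V ∈ C²` bounded with `∇V` bounded and
`|∇V|² ∈ L¹`, and any `b ∈ C¹(ℝ³)` — the `L¹` divergence theorem applied to the flux
`b(V) ∇V₁ × ∇V₂`, whose divergence is `(∂₀ b)(V) det ∇V` (`div (∇V₁ × ∇V₂) = 0`).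
[cite: Evans2010, §8.1.4.b (determinants are null Lagrangians)] -/
theorem integral_fderiv_comp_mul_det_eq_zero {V : EuclideanSpace ℝ (Fin 3) → EuclideanSpace ℝ (Fin 3)}
    (hV : ContDiff ℝ 2 V) {B : ℝ} (hB : ∀ x, ‖V x‖ ≤ B) {K : ℝ} (hK : ∀ x, ‖fderiv ℝ V x‖ ≤ K)
    (hint : Integrable fun x => frobeniusNormSq (fderiv ℝ V x)) {b : EuclideanSpace ℝ (Fin 3) → ℝ}
    (hb : ContDiff ℝ 1 b) :
    ∫ x, fderiv ℝ b (V x) (EuclideanSpace.single 0 1) * (fderiv ℝ V x).det = 0 := by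
  -- the coordinate functions and the flux field `Y = ∇V₁ × ∇V₂`
  have hVi2 : ∀ i : Fin 3, ContDiff ℝ 2 fun z => V z i := fun i =>
    (EuclideanSpace.proj i : EuclideanSpace ℝ (Fin 3) →L[ℝ] ℝ).contDiff.comp hV
  have hgi : ∀ i : Fin 3, ContDiff ℝ 1 (gradient fun z => V z i) := fun i =>
    contDiff_gradient_of_contDiff_succ (n := 1) (hVi2 i)
  have hdV : ∀ y, DifferentiableAt ℝ V y := fun y => (hV.differentiable (by simp)) y
  set Y : EuclideanSpace ℝ (Fin 3) → EuclideanSpace ℝ (Fin 3) :=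
    fun z => cross (gradient (fun z => V z 1) z) (gradient (fun z => V z 2) z) with hY
  have hY1 : ContDiff ℝ 1 Y := by
    have e : Y = fun z => crossCLM (gradient (fun z => V z 1) z) (gradient (fun z => V z 2) z) := by
      funext z; rw [hY]; rfl
    rw [e]
    exact crossCLM.isBoundedBilinearMap.contDiff.comp ((hgi 1).prodMk (hgi 2))
  have hdivY : ∀ y, VectorCalculus.divergence Y y = 0 := fun y =>
    divergence_cross_gradient_gradient (hVi2 1) (hVi2 2) y
  -- the weight `θ = b ∘ V`
  set θ : EuclideanSpace ℝ (Fin 3) → ℝ := fun z => b (V z) with hθ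
  have hθ1 : ContDiff ℝ 1 θ := hb.comp (hV.of_le (by norm_cast))
  have hdb : ∀ y, DifferentiableAt ℝ b y := fun y => (hb.differentiable one_ne_zero) y
  -- bounds for `b` and `Db` on the range of `V` (compactness)
  have hB0 : 0 ≤ B := (norm_nonneg _).trans (hB 0)
  have hK0 : 0 ≤ K := (norm_nonneg _).trans (hK 0)
  obtain ⟨Bθ, hBθ⟩ := (isCompact_closedBall (0 : EuclideanSpace ℝ (Fin 3)) B).exists_bound_of_continuousOn
    hb.continuous.continuousOn
  obtain ⟨Kb, hKb⟩ := (isCompact_closedBall (0 : EuclideanSpace ℝ (Fin 3)) B).exists_bound_of_continuousOn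
    (hb.continuous_fderiv one_ne_zero).continuousOn
  have hVmem : ∀ x, V x ∈ Metric.closedBall (0 : EuclideanSpace ℝ (Fin 3)) B := fun x =>
    mem_closedBall_zero_iff.2 (hB x)
  have hθb : ∀ x, ‖θ x‖ ≤ Bθ := fun x => hBθ _ (hVmem x)
  have hBθ0 : 0 ≤ Bθ := (norm_nonneg _).trans (hθb 0)
  have hKb0 : 0 ≤ Kb := (norm_nonneg _).trans (hKb _ (hVmem 0))
  -- continuity
  have cY : Continuous Y := hY1.continuous
  have cθ : Continuous θ := hθ1.continuous
  have cgθ : Continuous (gradient θ) := by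
    have : gradient θ = fun x => (InnerProductSpace.toDual ℝ _).symm (fderiv ℝ θ x) := rfl
    rw [this]
    exact (InnerProductSpace.toDual ℝ (EuclideanSpace ℝ (Fin 3))).symm.continuous.comp
      (hθ1.continuous_fderiv one_ne_zero)
  -- the pointwise identity `⟪Y, ∇θ⟫ = (∂₀ b)(V) det DV`
  have hpt : ∀ x, ⟪Y x, gradient θ x⟫ = fderiv ℝ b (V x) (EuclideanSpace.single 0 1) * (fderiv ℝ V x).det :=
    fun x => inner_cross_gradient_comp (hdV x) (hdb (V x))
  -- integrability of `θ • Y`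
  have hint1 : Integrable (fun x => θ x • Y x) := by
    refine Integrable.mono' (hint.const_mul (Bθ * (1 / 2))) (cθ.smul cY).aestronglyMeasurable
      (Eventually.of_forall fun x => ?_)
    rw [norm_smul]
    calc ‖θ x‖ * ‖Y x‖ ≤ Bθ * ((1 / 2) * frobeniusNormSq (fderiv ℝ V x)) :=
          mul_le_mul (hθb x) (norm_cross_gradient_le (hdV x)) (norm_nonneg _) hBθ0
      _ = Bθ * (1 / 2) * frobeniusNormSq (fderiv ℝ V x) := by ring
  -- integrability of `θ div Y = 0`
  have hint2 : Integrable (fun x => θ x * VectorCalculus.divergence Y x) := by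
    have : (fun x => θ x * VectorCalculus.divergence Y x) = fun _ => 0 := by
      funext x; rw [hdivY x, mul_zero]
    rw [this]; exact integrable_zero _ _ _
  -- integrability of `⟪Y, ∇θ⟫`
  have hint3 : Integrable (fun x => ⟪Y x, gradient θ x⟫) := by
    refine Integrable.mono' (hint.const_mul (Kb * ((1 / 2) * K))) (cY.inner cgθ).aestronglyMeasurable
      (Eventually.of_forall fun x => ?_)
    rw [hpt x, norm_mul, Real.norm_eq_abs, Real.norm_eq_abs]
    have h1 : |fderiv ℝ b (V x) (EuclideanSpace.single 0 1)| ≤ Kb := by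
      calc |fderiv ℝ b (V x) (EuclideanSpace.single 0 1)| = ‖fderiv ℝ b (V x) (EuclideanSpace.single 0 1)‖ :=
            (Real.norm_eq_abs _).symm
        _ ≤ ‖fderiv ℝ b (V x)‖ * ‖(EuclideanSpace.single 0 (1 : ℝ) : EuclideanSpace ℝ (Fin 3))‖ :=
            (fderiv ℝ b (V x)).le_opNorm _
        _ ≤ Kb * 1 := mul_le_mul (hKb _ (hVmem x)) (by simp) (norm_nonneg _) hKb0
        _ = Kb := mul_one _
    have h2 : |(fderiv ℝ V x).det| ≤ (1 / 2) * K * frobeniusNormSq (fderiv ℝ V x) :=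
      (abs_det_fderiv_le (hdV x)).trans (by
        gcongr
        · exact frobeniusNormSq_nonneg _
        · exact hK x)
    calc |fderiv ℝ b (V x) (EuclideanSpace.single 0 1)| * |(fderiv ℝ V x).det|
        ≤ Kb * ((1 / 2) * K * frobeniusNormSq (fderiv ℝ V x)) :=
          mul_le_mul h1 h2 (abs_nonneg _) hKb0
      _ = Kb * ((1 / 2) * K) * frobeniusNormSq (fderiv ℝ V x) := by ring
  -- the divergence theorem
  have key := integral_mul_divergence_add_eq_zero_of_integrable hθ1 hY1 hint1 hint2 hint3
  have h0 : ∫ x, θ x * VectorCalculus.divergence Y x = 0 := by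
    simp_rw [hdivY, mul_zero, integral_zero]
  rw [h0, zero_add] at key
  rw [← key]
  exact integral_congr_ae (Eventually.of_forall fun x => (hpt x).symm)

/-- **Global null-Lagrangian identity** `∫ det ∇V = 0` (the case `b y = y₀` of the core lemma). [cite: Evans2010, §8.1.4.b (determinants are null Lagrangians)] -/
theorem integral_det_fderiv_eq_zero {V : EuclideanSpace ℝ (Fin 3) → EuclideanSpace ℝ (Fin 3)}
    (hV : ContDiff ℝ 2 V) {B : ℝ} (hB : ∀ x, ‖V x‖ ≤ B) {K : ℝ} (hK : ∀ x, ‖fderiv ℝ V x‖ ≤ K)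
    (hint : Integrable fun x => frobeniusNormSq (fderiv ℝ V x)) :
    ∫ x, (fderiv ℝ V x).det = 0 := by
  have hb : ContDiff ℝ 1 fun y : EuclideanSpace ℝ (Fin 3) => y 0 :=
    (EuclideanSpace.proj (0 : Fin 3) : EuclideanSpace ℝ (Fin 3) →L[ℝ] ℝ).contDiff
  have h := integral_fderiv_comp_mul_det_eq_zero hV hB hK hint hb
  have hd : ∀ y : EuclideanSpace ℝ (Fin 3),
      fderiv ℝ (fun y : EuclideanSpace ℝ (Fin 3) => y 0) y (EuclideanSpace.single 0 1) = 1 := by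
    intro y
    rw [show (fun y : EuclideanSpace ℝ (Fin 3) => y 0) =
      (EuclideanSpace.proj (0 : Fin 3) : EuclideanSpace ℝ (Fin 3) →L[ℝ] ℝ) from rfl,
      ContinuousLinearMap.fderiv]
    simp
  simpa [hd] using h

/-- The primitive of a smooth `f` along the first coordinate axis of velocity space,
`b y = ∫₀^{y₀} f(y + (s − y₀) e₀) ds`, is `C¹` (tree: `contDiff_parametric_primitive`). [folklore] -/
theorem contDiff_linePrimitive {f : EuclideanSpace ℝ (Fin 3) → ℝ} (hf : ContDiff ℝ ∞ f) :
    ContDiff ℝ 1 fun y : EuclideanSpace ℝ (Fin 3) =>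
      ∫ s in (0 : ℝ)..(y 0), f (y + (s - y 0) • EuclideanSpace.single 0 1) := by
  set G : ℝ × EuclideanSpace ℝ (Fin 3) → ℝ :=
    fun p => f (p.2 + (p.1 - p.2 0) • EuclideanSpace.single 0 1) with hG
  have hproj : ContDiff ℝ ∞ fun y : EuclideanSpace ℝ (Fin 3) => y 0 :=
    (EuclideanSpace.proj (0 : Fin 3) : EuclideanSpace ℝ (Fin 3) →L[ℝ] ℝ).contDiff
  have hGs : ContDiff ℝ ∞ G := by
    refine hf.comp (contDiff_snd.add ((contDiff_fst.sub (hproj.comp contDiff_snd)).smul contDiff_const))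
  have hH := contDiff_parametric_primitive hGs
  have hpair : ContDiff ℝ ∞ fun y : EuclideanSpace ℝ (Fin 3) => (y, y 0) := contDiff_id.prodMk hproj
  have hcomp := hH.comp hpair
  exact hcomp.of_le (by norm_cast)

/-- `∂₀ b = f` for the line primitive `b` of `f` (fundamental theorem of calculus along the line `y + t e₀`). [folklore] -/
theorem fderiv_linePrimitive_apply {f : EuclideanSpace ℝ (Fin 3) → ℝ} (hf : ContDiff ℝ ∞ f)
    (y : EuclideanSpace ℝ (Fin 3)) :
    fderiv ℝ (fun y : EuclideanSpace ℝ (Fin 3) =>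
      ∫ s in (0 : ℝ)..(y 0), f (y + (s - y 0) • EuclideanSpace.single 0 1)) y (EuclideanSpace.single 0 1) =
      f y := by
  set e0 : EuclideanSpace ℝ (Fin 3) := EuclideanSpace.single 0 1 with he0
  set b : EuclideanSpace ℝ (Fin 3) → ℝ := fun y => ∫ s in (0 : ℝ)..(y 0), f (y + (s - y 0) • e0) with hb
  have hb1 : ContDiff ℝ 1 b := contDiff_linePrimitive hf
  -- the line `L t = y + t e₀` and the slice `F s = f (y + (s - y₀) e₀)`
  set L : ℝ → EuclideanSpace ℝ (Fin 3) := fun t => y + t • e0 with hL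
  set F : ℝ → ℝ := fun s => f (y + (s - y 0) • e0) with hF
  have hL0 : L 0 = y := by simp [hL]
  have hLd : HasDerivAt L e0 0 := by
    have h := ((hasDerivAt_id (0 : ℝ)).smul_const e0).const_add y
    simpa [hL] using h
  have he00 : e0 0 = 1 := by simp [he0]
  have hLt0 : ∀ t, L t 0 = y 0 + t := by
    intro t; simp [hL, he00]
  have hbL : ∀ t, b (L t) = ∫ s in (0 : ℝ)..(y 0 + t), F s := by
    intro t
    simp only [hb, hF, hLt0]
    refine intervalIntegral.integral_congr fun s _ => ?_
    simp only [hL]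
    congr 1
    rw [show y + t • e0 + (s - (y 0 + t)) • e0 = y + (t • e0 + (s - (y 0 + t)) • e0) from add_assoc _ _ _,
      ← add_smul]
    congr 2; ring
  -- derivative along the line, two ways
  have cF : Continuous F :=
    hf.continuous.comp (continuous_const.add ((continuous_id.sub continuous_const).smul continuous_const))
  have h1 : HasDerivAt (fun t => b (L t)) (fderiv ℝ b y e0) 0 := by
    have hd : DifferentiableAt ℝ b (L 0) := by rw [hL0]; exact (hb1.differentiable one_ne_zero) y
    have h := hd.hasFDerivAt.comp_hasDerivAt (0 : ℝ) hLd
    rw [hL0] at h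
    exact h
  have h2 : HasDerivAt (fun t => b (L t)) (f y) 0 := by
    have hprim : HasDerivAt (fun u => ∫ s in (0 : ℝ)..u, F s) (F (y 0 + 0)) (y 0 + 0) :=
      intervalIntegral.integral_hasDerivAt_right (cF.intervalIntegrable _ _)
        (cF.stronglyMeasurableAtFilter _ _) cF.continuousAt
    have hu : HasDerivAt (fun t : ℝ => y 0 + t) 1 0 := by
      simpa using (hasDerivAt_id (0 : ℝ)).const_add (y 0)
    have h := hprim.comp (0 : ℝ) hu
    have hF0 : F (y 0 + 0) = f y := by simp [hF]
    rw [hF0, mul_one] at h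
    refine h.congr_of_eventuallyEq (Eventually.of_forall fun t => ?_)
    exact hbL t
  exact h1.unique h2

/-- **Slow-class null-Lagrangian identity** `∫_{‖V‖ ≤ l} det ∇V = 0` (`l > 0`): the core lemma
with the line primitives of the bumps `φₙ` (`= 1` on `closedBall 0 l`, `= 0` off
`ball 0 (l + 1/(n+1))`), then dominated convergence (`|φₙ(V) det ∇V| ≤ |det ∇V| ∈ L¹`,
`φₙ(V) → 1_{‖V‖ ≤ l}` pointwise). [cite: Evans2010, §8.1.4.b (determinants are null Lagrangians)] -/
theorem setIntegral_slowClass_det_fderiv_eq_zero {V : EuclideanSpace ℝ (Fin 3) → EuclideanSpace ℝ (Fin 3)}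
    (hV : ContDiff ℝ 2 V) {B : ℝ} (hB : ∀ x, ‖V x‖ ≤ B) {K : ℝ} (hK : ∀ x, ‖fderiv ℝ V x‖ ≤ K)
    (hint : Integrable fun x => frobeniusNormSq (fderiv ℝ V x)) {l : ℝ} (hl : 0 < l) :
    ∫ x in {x | ‖V x‖ ≤ l}, (fderiv ℝ V x).det = 0 := by
  have hdV : ∀ y, DifferentiableAt ℝ V y := fun y => (hV.differentiable (by simp)) y
  have hK0 : 0 ≤ K := (norm_nonneg _).trans (hK 0)
  -- the bumps `φ n = 1` on `closedBall 0 l`, `= 0` off `ball 0 (l + 1/(n+1))`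
  set φ : ℕ → ContDiffBump (0 : EuclideanSpace ℝ (Fin 3)) := fun n =>
    ⟨l, l + 1 / ((n : ℝ) + 1), hl, by linarith [show (0 : ℝ) < 1 / ((n : ℝ) + 1) by positivity]⟩ with hφ
  -- each `∫ φₙ(V) det DV = 0`
  have hzero : ∀ n : ℕ, ∫ x, (φ n) (V x) * (fderiv ℝ V x).det = 0 := by
    intro n
    have hf : ContDiff ℝ ∞ (φ n : EuclideanSpace ℝ (Fin 3) → ℝ) := (φ n).contDiff
    have h := integral_fderiv_comp_mul_det_eq_zero hV hB hK hint (contDiff_linePrimitive hf)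
    simp_rw [fderiv_linePrimitive_apply hf] at h
    exact h
  -- the slow set
  set S : Set (EuclideanSpace ℝ (Fin 3)) := {x | ‖V x‖ ≤ l} with hS
  have hSm : MeasurableSet S := (isClosed_le hV.continuous.norm continuous_const).measurableSet
  -- dominated convergence
  set Fs : ℕ → EuclideanSpace ℝ (Fin 3) → ℝ := fun n x => (φ n) (V x) * (fderiv ℝ V x).det with hFs
  have cdet : Continuous fun x => (fderiv ℝ V x).det :=
    ContinuousLinearMap.continuous_det.comp (hV.continuous_fderiv (by simp))
  have hmeas : ∀ n, AEStronglyMeasurable (Fs n) volume := fun n =>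
    (((φ n).continuous.comp hV.continuous).mul cdet).aestronglyMeasurable
  have hbound_int : Integrable (fun x => |(fderiv ℝ V x).det|) := by
    refine Integrable.mono' (hint.const_mul ((1 / 2) * K)) cdet.abs.aestronglyMeasurable
      (Eventually.of_forall fun x => ?_)
    rw [Real.norm_eq_abs, abs_abs]
    calc |(fderiv ℝ V x).det| ≤ (1 / 2) * ‖fderiv ℝ V x‖ * frobeniusNormSq (fderiv ℝ V x) :=
          abs_det_fderiv_le (hdV x)
      _ ≤ (1 / 2) * K * frobeniusNormSq (fderiv ℝ V x) := by
          gcongr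
          · exact frobeniusNormSq_nonneg _
          · exact hK x
  have hbound : ∀ n, ∀ᵐ x ∂volume, ‖Fs n x‖ ≤ |(fderiv ℝ V x).det| := fun n =>
    Eventually.of_forall fun x => by
      rw [hFs]; dsimp only
      rw [norm_mul, Real.norm_eq_abs, Real.norm_eq_abs, abs_of_nonneg ((φ n).nonneg)]
      exact mul_le_of_le_one_left (abs_nonneg _) ((φ n).le_one)
  have hlim : ∀ᵐ x ∂volume, Tendsto (fun n => Fs n x) atTop
      (𝓝 (S.indicator (fun x => (fderiv ℝ V x).det) x)) := by
    refine Eventually.of_forall fun x => ?_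
    by_cases hx : ‖V x‖ ≤ l
    · have hxS : x ∈ S := hx
      rw [indicator_of_mem hxS]
      have hconst : ∀ n, Fs n x = (fderiv ℝ V x).det := by
        intro n
        rw [hFs]; dsimp only
        rw [(φ n).one_of_mem_closedBall (by simpa using hx), one_mul]
      simp_rw [hconst]
      exact tendsto_const_nhds
    · have hxS : x ∉ S := hx
      rw [indicator_of_notMem hxS]
      push Not at hx
      obtain ⟨N, hN⟩ := exists_nat_one_div_lt (sub_pos.2 hx)
      refine tendsto_const_nhds.congr' ?_
      filter_upwards [Filter.eventually_ge_atTop N] with n hn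
      rw [hFs]; dsimp only
      rw [(φ n).zero_of_le_dist, zero_mul]
      rw [dist_zero_right]
      change l + 1 / ((n : ℝ) + 1) ≤ ‖V x‖
      have hmono : 1 / ((n : ℝ) + 1) ≤ 1 / ((N : ℝ) + 1) := by
        apply one_div_le_one_div_of_le (by positivity)
        exact_mod_cast Nat.succ_le_succ hn
      linarith
  have hDCT := tendsto_integral_of_dominated_convergence _ hmeas hbound_int hbound hlim
  rw [integral_indicator hSm] at hDCT
  have h0 : Tendsto (fun n => ∫ x, Fs n x) atTop (𝓝 0) := by
    simp_rw [hFs, hzero]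
    exact tendsto_const_nhds
  exact tendsto_nhds_unique hDCT h0


/-- **The slow-class null-Lagrangian identity, registered helper-stub form.** For `V ∈ C²(ℝ³; ℝ³)`
bounded, with bounded gradient and `|∇V|²_F ∈ L¹`, and every level `l > 0`:
`∫_{‖V‖ ≤ l} det ∇V dx = 0`. [cite: Evans2010, §8.1.4.b (determinants are null Lagrangians)] -/
theorem slowClass_det_integral_eq_zero :
    ∀ (V : EuclideanSpace ℝ (Fin 3) → EuclideanSpace ℝ (Fin 3)), ContDiff ℝ 2 V →
      (∃ B : ℝ, ∀ x, ‖V x‖ ≤ B) → (∃ K : ℝ, ∀ x, ‖fderiv ℝ V x‖ ≤ K) →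
      MeasureTheory.Integrable (fun x => frobeniusNormSq (fderiv ℝ V x)) →
      ∀ l : ℝ, 0 < l → ∫ x in {x | ‖V x‖ ≤ l}, (fderiv ℝ V x).det = 0 := by
  intro V hV hB hK hint l hl
  obtain ⟨B, hB⟩ := hB
  obtain ⟨K, hK⟩ := hK
  exact setIntegral_slowClass_det_fderiv_eq_zero hV hB hK hint hl

end Summit.NavierStokesRegularity.NavierStokesRegularity.Theorems.ClassBudgetsRegularise

end
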